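import Literature.Probability.Independence.LindebergFellerCLT
import Literature.Probability.HeavyTails.TruncatedMomentTailSum
import Literature.Probability.HeavyTails.TailIndexCLTDichotomy
import Literature.Analysis.Asymptotics.KaramataIntegralTheorem
import Mathlib.MeasureTheory.Function.ConvergenceInDistribution
import Mathlib.Analysis.MeanInequalities
import HarnessLib

/-!
# Is a truncated heavy tail heavy or not? Soft and hard truncation regimes
# (Chakrabarty–Samorodnitsky 2012, Theorems 2.1 and 2.2, Proposition 4.1 (ii))

Topic `Literature/Probability/HeavyTails`; namespace
`Literature.Probability.HeavyTails.TruncatedHeavyTails`. THEOREMS ONLY (no definition, no named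
fact): everything is proved, from the tree's Lindeberg–Feller theorem
(`Literature/Probability/Independence/LindebergFellerCLT.lean`, Durrett Thm 3.4.10) and the tree's
Feller VIII.9 / XVII.5 (5.16) files (`TruncatedMomentTailSum.lean`).

Source, VERBATIM (held text `paper:arxiv-1001.3218`, chunks p0003–p0006): A. Chakrabarty,
G. Samorodnitsky, *Understanding heavy tails in a bounded world or, is a truncated heavy tail heavy
or not?*, Stochastic Models 28 (2012) 109–143 = arXiv:1001.3218. The model (1.2): "`X_{nj} :=
H_j 𝟙(‖H_j‖ ≤ M_n) + (H_j/‖H_j‖)(M_n + R_j) 𝟙(‖H_j‖ > M_n)`, `j = 1,…,n`, `n = 1,2,…`. Here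
`H_1, H_2, …` are i.i.d. random vectors in `ℝ^d` with the common law `F` that has regularly varying
tails with a tail exponent `α ∈ (0,2)`, and `R_1, R_2, …` … i.i.d. nonnegative random variables."
(1.3): "We will say that the tails in the model (1.2) are truncated softly if
`lim_{n→∞} nP(‖H_1‖ > M_n) = 0`, truncated hard if `lim_{n→∞} nP(‖H_1‖ > M_n) = ∞`."
"**Theorem 2.1.** In the soft truncation regime we have `b_n^{-1}S_n − c_n ⟹ ρ`" (where
`b_n^{-1} Σ_{j≤n} H_j − c_n ⟹ ρ`, (2.1)); proof: "it is enough to show that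
`b_n^{-1}‖S_n − Σ_{j=1}^n H_j‖ → 0` in probability. However, for any `ε > 0`,
`P(b_n^{-1}‖S_n − Σ H_j‖ > ε) ≤ P(‖H_j‖ > M_n for some j = 1,…,n) ≤ nP(‖H_1‖ > M_n) → 0`."
"**Theorem 2.2.** Assume that `ER_1² < ∞`, and let `B_n := [n M_n² P(‖H_1‖ > M_n)]^{1/2}`,
`n = 1,2,…`. Then in the hard truncation regime we have `B_n^{-1}(S_n − ES_n) ⟹ η`, where `η` is a
centered Gaussian law on `ℝ^d` whose covariance matrix has the entries
`(2/(2−α)) ∫_S s_i s_j Γ̃(ds)`"; proof: "we will use the Central Limit Theorem for triangular arrays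
under the Lindeberg condition … `lim n B_n^{-2} Var(⟨θ,X_{n1}⟩) = (2/(2−α))∫⟨θ,s⟩²Γ̃(ds)` (2.6) …
`lim n^{1/2} B_n^{-1} |E⟨θ,X_{n1}⟩| = 0` (2.9) … the remaining condition (Lindeberg) … is an
immediate consequence of the fact that the hard truncation implies that `B_n ≫ M_n`." Lemma 2.1's
second-moment asymptotics rest on "the Karamata theorem".

TYPED HERE, in dimension `d = 1` with `R_j ≡ 0` (so `H_j/‖H_j‖ · M_n = sign(H_j) M_n` and
`X_{nj} = max(−M_n, min(H_j, M_n))` is `H_j` clipped to `[−M_n, M_n]`; `S = {±1}`, `∫ s² Γ̃ = 1`):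
* law-level asymptotics for the clipped variable, `ν` = law of `H`, `T(M) = ν{|y| > M}`
  regularly varying with exponent `−α`, `0 < α < 2` (tree carrier `IsSlowlyVarying (T/·^{−α})`):
  `integral_clip_sq_eq` (`E X² = ∫_{[−M,M]} y² dν + M² T(M)`), `tendsto_integral_clip_sq_div`
  (`E X²/(M² T(M)) → 2/(2−α)`, from Feller (5.16) in the tree = the paper's Lemma 2.1 for `d = 1`),
  `tendsto_sq_integral_clip_div` (`(E X)²/(M²T(M)) → 0`, the paper's (2.9)),
  `tendsto_variance_clip_div` (`Var X/(M² T(M)) → 2/(2−α)`, the paper's (2.6));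
* **`tendstoInDistribution_iff_of_soft`** — Theorem 2.1 in limit-free form: under soft
  truncation, for ANY norming `b_n`, centring `c_n` and candidate limit `Z`,
  `b_n^{-1}S_n − c_n ⟹ Z ↔ b_n^{-1} Σ_{j<n} H_j − c_n ⟹ Z` (only identical distribution of the
  `H_j` is used, as in the printed proof; no stable law is needed to state it);
* `not_tendstoInDistribution_sqrt_of_soft` — Theorem 2.1 composed with the tree's
  `TailIndexCLTDichotomy.lean` (Kallenberg Thm 5.17): in the soft regime, for a nonnegative `H`
  with `0 < α < 2`, `S_n/√n − c_n` converges in distribution for NO centring `c_n` and NO limit;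
* **`tendstoInDistribution_of_hard`** — Theorem 2.2 (`d = 1`, `R ≡ 0`): i.i.d. `H_j` with
  regularly varying tail sum of exponent `−α ∈ (−2, 0)`, `M_n → ∞` with `nP(|H| > M_n) → ∞`;
  then `B_n^{-1}(S_n − ES_n) ⟹ √(2/(2−α))·Z`, `Z ~ N(0,1)`;
* **`tendsto_measure_exists_share_ge_of_hard`** — Proposition 4.1 (ii) in share form (any
  `α > 0`, `A > 0`): under hard truncation, for every `ε > 0`,
  `P(∃ j < n, |X_{nj}|^A ≥ ε Σ_{i<n} |X_{ni}|^A) → 0`, i.e. `Z_n(A) = Σ_i|X_i|^A / max_i|X_i|^A → ∞`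
  in probability (binomial Chebyshev count of the observations in `(M_n/2, M_n]`, whose number is
  `≈ (2^α − 1) nP(|H| > M_n) → ∞`, as in the printed proof).
Scope notes. (i) `M_n → ∞` is assumed explicitly (the print uses it through Karamata's theorem in
Lemma 2.1). (ii) NOT here: `d > 1`, the light-tailed overshoot `R_j`, the intermediate regime
(Remark 1: truncated-stable + Poisson limit), §3 (Hill estimator: Thm 3.1 consistency under
`nP(H > M_n) + 1 ≪ k_n ≪ n`), Proposition 4.1 (i) (soft ⇒ `Z_n(A) ⟹ Γ_1^{A/α} Σ_j Γ_j^{−A/α}`,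
point-process convergence), Propositions 4.2–4.4 and the tests' critical values, stable limits.
(Filed by the pub-qed TRACK «TROPICAL» literature seat, value-free: the printed dichotomy behind
«a bounded weight with a power-law body is Gaussian at sample size `N` only when `N·P_body(w > K)`
is large»; no verdict on any word.)

## References
* A. Chakrabarty, G. Samorodnitsky, *Understanding heavy tails in a bounded world or, is a
  truncated heavy tail heavy or not?*, Stochastic Models 28 (2012) 109–143, arXiv:1001.3218,
  Theorems 2.1, 2.2, Lemma 2.1. [cite: ChakrabartySamorodnitsky2012]
* R. Durrett, *Probability: Theory and Examples*, 5th ed., CUP 2019, Theorem 3.4.10.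
  [cite: Durrett2019]
* W. Feller, *An Introduction to Probability Theory and Its Applications* II, 2nd ed., Wiley 1971,
  XVII.5 (5.16). [cite: Feller1971]
* O. Kallenberg, *Foundations of Modern Probability*, 3rd ed., Springer 2021, Theorem 5.17.
  [cite: Kallenberg2021]
-/

noncomputable section

open MeasureTheory ProbabilityTheory Filter Finset Set
open Literature.Analysis.Asymptotics Literature.Probability.Independence
open scoped Topology ENNReal NNReal

namespace Literature.Probability.HeavyTails

namespace TruncatedHeavyTails

/-! ### The clipping map `y ↦ max(−M, min(y, M))` -/

/-- `|clip_M y| = min(|y|, M)` for `M ≥ 0`. [folklore] -/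
private theorem abs_clip_eq (M y : ℝ) (hM : 0 ≤ M) : |max (-M) (min y M)| = min |y| M := by
  rcases le_or_gt y M with h1 | h1
  · rw [min_eq_left h1]
    rcases le_or_gt (-M) y with h2 | h2
    · rw [max_eq_right h2, min_eq_left (abs_le.2 ⟨h2, h1⟩)]
    · have hyM : M ≤ |y| := by rw [abs_of_neg (by linarith)]; linarith
      rw [max_eq_left h2.le, abs_neg, abs_of_nonneg hM, min_eq_right hyM]
  · have hy : 0 ≤ y := by linarith
    have hMM : -M ≤ M := by linarith
    rw [min_eq_right h1.le, max_eq_right hMM, abs_of_nonneg hM, abs_of_nonneg hy,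
      min_eq_right h1.le]

/-- `|clip_M y| ≤ M` for `M ≥ 0`. [folklore] -/
private theorem abs_clip_le (M y : ℝ) (hM : 0 ≤ M) : |max (-M) (min y M)| ≤ M := by
  rw [abs_clip_eq M y hM]; exact min_le_right _ _

/-- `clip_M y = y` when `|y| ≤ M`. [folklore] -/
private theorem clip_eq_self {M y : ℝ} (h : |y| ≤ M) : max (-M) (min y M) = y := by
  rw [min_eq_left (abs_le.1 h).2, max_eq_right (abs_le.1 h).1]

/-- `(clip_M y)² = y²` on `[−M, M]` and `= M²` off it (`M ≥ 0`). [folklore] -/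
private theorem clip_sq_eq (M y : ℝ) (hM : 0 ≤ M) :
    (max (-M) (min y M)) ^ 2 =
      (Icc (-M) M).indicator (fun y => y ^ 2) y + {y | M < |y|}.indicator (fun _ => M ^ 2) y := by
  by_cases h : |y| ≤ M
  · have h1 : y ∈ Icc (-M) M := ⟨(abs_le.1 h).1, (abs_le.1 h).2⟩
    have h2 : y ∉ {y : ℝ | M < |y|} := fun hy => (not_lt.2 h) hy
    rw [indicator_of_mem h1, indicator_of_notMem h2, add_zero, clip_eq_self h]
  · push Not at h
    have h1 : y ∉ Icc (-M) M := fun hy => (not_le.2 h) (abs_le.2 ⟨hy.1, hy.2⟩)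
    have h2 : y ∈ {y : ℝ | M < |y|} := h
    rw [indicator_of_notMem h1, indicator_of_mem h2, zero_add, ← sq_abs, abs_clip_eq M y hM,
      min_eq_right h.le]

/-- The tail set `{y | M < |y|}` is measurable. [folklore] -/
private theorem measurableSet_tail (M : ℝ) : MeasurableSet {y : ℝ | M < |y|} :=
  measurableSet_lt measurable_const continuous_abs.measurable

/-! ### Law-level asymptotics of the clipped variable (Lemma 2.1 / (2.6) / (2.9), `d = 1`) -/

section Law

variable {ν : Measure ℝ} [IsProbabilityMeasure ν]

/-- **Second moment of the clipped variable**: `E X² = ∫_{[−M,M]} y² dν + M² ν{|y| > M}` — the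
decomposition `E(⟨θ,X⟩²) = E(H² 𝟙(|H| ≤ M)) + M² P(|H| > M)` of the paper's proof of (2.8) (with
`R ≡ 0`). [cite: ChakrabartySamorodnitsky2012, Theorem 2.2 (proof, (2.8))] -/
theorem integral_clip_sq_eq {M : ℝ} (hM : 0 ≤ M) :
    ∫ y, (max (-M) (min y M)) ^ 2 ∂ν = truncMomentFun ν M + M ^ 2 * ν.real {y | M < |y|} := by
  have h1 : Integrable ((Icc (-M) M).indicator fun y : ℝ => y ^ 2) ν :=
    ((continuous_pow 2).continuousOn.integrableOn_compact isCompact_Icc).integrable_indicator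
      measurableSet_Icc
  have h2 : Integrable ({y : ℝ | M < |y|}.indicator fun _ => M ^ 2) ν :=
    (integrable_const _).indicator (measurableSet_tail M)
  simp_rw [clip_sq_eq M _ hM]
  rw [integral_add h1 h2, integral_indicator measurableSet_Icc,
    integral_indicator (measurableSet_tail M), setIntegral_const, smul_eq_mul, truncMomentFun_def,
    mul_comm]

/-- The tail function `T(t) = ν{|y| > t}` is antitone, hence measurable. [folklore] -/
private theorem measurable_tail : Measurable fun t : ℝ => ν.real {y | t < |y|} := by
  have hanti : Antitone fun t : ℝ => ν.real {y | t < |y|} := fun a b hab =>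
    measureReal_mono fun y (hy : b < |y|) => lt_of_le_of_lt hab hy
  exact hanti.measurable

omit [IsProbabilityMeasure ν] in
/-- A regularly varying tail sum is eventually positive as a slowly varying quotient (with Lean's
`0/0 = 0`, slow variation forces `T(t)/t^{−α} ≠ 0` eventually). [folklore] -/
private theorem eventually_pos_of_rv {α : ℝ}
    (hrv : IsSlowlyVarying fun t => ν.real {y | t < |y|} / t ^ (-α)) :
    ∀ᶠ t in atTop, 0 < ν.real {y | t < |y|} / t ^ (-α) := by
  have h2 := (hrv 1 one_pos).eventually (Ioi_mem_nhds (by norm_num : (1 / 2 : ℝ) < 1))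
  filter_upwards [h2, eventually_gt_atTop 0] with t ht ht0
  have ht' : 1 / 2 < ν.real {y | 1 * t < |y|} / (1 * t) ^ (-α) /
      (ν.real {y | t < |y|} / t ^ (-α)) := ht
  have hL0 : 0 ≤ ν.real {y | t < |y|} / t ^ (-α) :=
    div_nonneg measureReal_nonneg (Real.rpow_nonneg ht0.le _)
  rcases hL0.eq_or_lt with h | h
  · rw [← h, div_zero] at ht'; linarith
  · exact h

/-- `M² ν{|y| > M} = M^{2−α} ℓ(M) → ∞` for a regularly varying tail sum with `α < 2`.
[cite: Feller1971, XVII.5 (5.16)] -/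
theorem tendsto_sq_mul_tail_atTop {α : ℝ} (hα2 : α < 2)
    (hrv : IsSlowlyVarying fun t => ν.real {y | t < |y|} / t ^ (-α)) :
    Tendsto (fun M : ℝ => M ^ 2 * ν.real {y | M < |y|}) atTop atTop := by
  have hmeas : Measurable fun t : ℝ => ν.real {y | t < |y|} / t ^ (-α) :=
    measurable_tail.div (measurable_id.pow_const _)
  refine (hrv.tendsto_rpow_mul_atTop hmeas (eventually_pos_of_rv hrv) (ρ := 2 - α)
    (by linarith)).congr' ?_
  filter_upwards [eventually_gt_atTop 0] with t ht0
  have h1 : t ^ (-α) ≠ 0 := (Real.rpow_pos_of_pos ht0 _).ne'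
  have e : t ^ (2 - α) = t ^ 2 * t ^ (-α) := by
    rw [← Real.rpow_two, ← Real.rpow_add ht0, sub_eq_add_neg]
  rw [e]
  field_simp

/-- **(2.8), `d = 1`**: `E X²/(M² P(|H| > M)) → α/(2−α) + 1 = 2/(2−α)` as `M → ∞` (Lemma 2.1 via
Feller's (5.16): `∫_{[−M,M]} y² dν ∼ (α/(2−α)) M² P(|H| > M)`).
[cite: ChakrabartySamorodnitsky2012, Lemma 2.1 and (2.8)] -/
theorem tendsto_integral_clip_sq_div {α : ℝ} (hα0 : 0 < α) (hα2 : α < 2)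
    (hrv : IsSlowlyVarying fun t => ν.real {y | t < |y|} / t ^ (-α)) :
    Tendsto (fun M : ℝ => (∫ y, (max (-M) (min y M)) ^ 2 ∂ν) / (M ^ 2 * ν.real {y | M < |y|}))
      atTop (𝓝 (2 / (2 - α))) := by
  have h516 := TruncatedMomentTailSum.tendsto_sq_mul_tailSum_div_truncMomentFun_of_tailSum
    (μ := ν) hα0 hα2 hrv
  have hne : (2 - α) / α ≠ 0 := div_ne_zero (by linarith) hα0.ne'
  -- `U(M)/(M² T(M)) → α/(2−α)`
  have hinv : Tendsto (fun M : ℝ => truncMomentFun ν M / (M ^ 2 * ν.real {y | M < |y|})) atTop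
      (𝓝 (α / (2 - α))) := by
    have := h516.inv₀ hne
    rw [inv_div] at this
    refine this.congr fun M => ?_
    rw [inv_div]
  have hD := tendsto_sq_mul_tail_atTop hα2 hrv
  have h2α : 2 - α ≠ 0 := ne_of_gt (sub_pos.2 hα2)
  have e : 2 / (2 - α) = α / (2 - α) + 1 := by field_simp; ring
  rw [e]
  refine (hinv.add_const 1).congr' ?_
  filter_upwards [hD.eventually_gt_atTop 0, eventually_ge_atTop 0] with M hM hM0
  rw [integral_clip_sq_eq hM0, add_div, div_self hM.ne']

/-- The tail `ν{|y| > L} → 0` as `L → ∞`. [folklore] -/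
private theorem tendsto_tail_zero : Tendsto (fun L : ℝ => ν.real {y | L < |y|}) atTop (𝓝 0) := by
  have hanti : Antitone fun L : ℝ => {y : ℝ | L < |y|} := fun a b hab y (hy : b < |y|) =>
    lt_of_le_of_lt hab hy
  have h := tendsto_measure_iInter_atTop (μ := ν) (fun L => (measurableSet_tail L).nullMeasurableSet)
    hanti ⟨0, measure_ne_top _ _⟩
  have hempty : ⋂ L : ℝ, {y : ℝ | L < |y|} = ∅ := by
    ext y
    simp only [mem_iInter, mem_setOf_eq, mem_empty_iff_false, iff_false, not_forall, not_lt]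
    exact ⟨|y|, le_rfl⟩
  rw [hempty, measure_empty] at h
  have h' := (ENNReal.tendsto_toReal ENNReal.zero_ne_top).comp h
  rw [ENNReal.toReal_zero] at h'
  exact h'.congr fun L => rfl

/-- **Cauchy–Schwarz split of the first absolute moment** (the device behind (2.9)): for
`0 ≤ L`, `(E|X|)² ≤ 2L² + 2 E X² · ν{|y| > L}`, where `X = clip_M H`.
[cite: ChakrabartySamorodnitsky2012, Theorem 2.2 (proof, (2.9))] -/
theorem sq_integral_abs_clip_le {M L : ℝ} (hM : 0 ≤ M) (hL : 0 ≤ L) :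
    (∫ y, |max (-M) (min y M)| ∂ν) ^ 2 ≤
      2 * L ^ 2 + 2 * (∫ y, (max (-M) (min y M)) ^ 2 ∂ν) * ν.real {y | L < |y|} := by
  set f : ℝ → ℝ := fun y => |max (-M) (min y M)| with hf
  set g : ℝ → ℝ := {y : ℝ | L < |y|}.indicator fun _ => (1 : ℝ) with hg
  have hfm : Measurable f :=
    ((measurable_const.max (measurable_id.min measurable_const))).abs
  have hgm : Measurable g := measurable_const.indicator (measurableSet_tail L)
  have hf_nn : ∀ y, 0 ≤ f y := fun y => abs_nonneg _
  have hg_nn : ∀ y, 0 ≤ g y := fun y => by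
    simp only [hg, indicator_apply]; split_ifs <;> norm_num
  have hg_le : ∀ y, g y ≤ 1 := fun y => by
    simp only [hg, indicator_apply]; split_ifs <;> norm_num
  have hf_bdd : ∀ y, f y ≤ M := fun y => abs_clip_le M y hM
  have hfL2 : MemLp f 2 ν := MemLp.of_bound hfm.aestronglyMeasurable M
    (Eventually.of_forall fun y => by rw [Real.norm_eq_abs, abs_of_nonneg (hf_nn y)]; exact hf_bdd y)
  have hgL2 : MemLp g 2 ν := MemLp.of_bound hgm.aestronglyMeasurable 1
    (Eventually.of_forall fun y => by rw [Real.norm_eq_abs, abs_of_nonneg (hg_nn y)]; exact hg_le y)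
  have hfint : Integrable f ν := hfL2.integrable one_le_two
  -- pointwise split `f ≤ L + f·g`
  have hsplit : ∀ y, f y ≤ L + f y * g y := by
    intro y
    by_cases hy : L < |y|
    · have : g y = 1 := by simp [hg, hy]
      rw [this, mul_one]; linarith
    · have : g y = 0 := by simp [hg, hy]
      rw [this, mul_zero, add_zero]
      push Not at hy
      calc f y = min |y| M := abs_clip_eq M y hM
        _ ≤ |y| := min_le_left _ _
        _ ≤ L := hy
  -- Cauchy–Schwarz for `∫ f g`
  have hCS : (∫ y, f y * g y ∂ν) ^ 2 ≤ (∫ y, f y ^ 2 ∂ν) * ν.real {y | L < |y|} := by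
    have h := integral_mul_le_Lp_mul_Lq_of_nonneg (μ := ν) Real.HolderConjugate.two_two
      (Eventually.of_forall hf_nn) (Eventually.of_forall hg_nn)
      (by rw [show ENNReal.ofReal 2 = 2 by norm_num]; exact hfL2)
      (by rw [show ENNReal.ofReal 2 = 2 by norm_num]; exact hgL2)
    have hg2 : ∫ y, g y ^ (2 : ℝ) ∂ν = ν.real {y | L < |y|} := by
      have : (fun y => g y ^ (2 : ℝ)) = {y : ℝ | L < |y|}.indicator fun _ => (1 : ℝ) := by
        funext y
        simp only [hg, indicator_apply]
        split_ifs <;> norm_num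
      rw [this, integral_indicator (measurableSet_tail L), setIntegral_const, smul_eq_mul, mul_one]
    have hf2 : ∫ y, f y ^ (2 : ℝ) ∂ν = ∫ y, f y ^ 2 ∂ν := by
      refine integral_congr_ae (Eventually.of_forall fun y => ?_)
      simp only [Real.rpow_two]
    rw [hg2, hf2] at h
    have hA : 0 ≤ ∫ y, f y ^ 2 ∂ν := integral_nonneg fun y => sq_nonneg _
    have hB : 0 ≤ ν.real {y | L < |y|} := measureReal_nonneg
    have hfg : 0 ≤ ∫ y, f y * g y ∂ν := integral_nonneg fun y => mul_nonneg (hf_nn y) (hg_nn y)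
    calc (∫ y, f y * g y ∂ν) ^ 2
        ≤ ((∫ y, f y ^ 2 ∂ν) ^ (1 / (2 : ℝ)) * (ν.real {y | L < |y|}) ^ (1 / (2 : ℝ))) ^ 2 :=
          pow_le_pow_left₀ hfg h 2
      _ = (∫ y, f y ^ 2 ∂ν) * ν.real {y | L < |y|} := by
          rw [mul_pow, ← Real.rpow_natCast _ 2, ← Real.rpow_natCast _ 2, ← Real.rpow_mul hA,
            ← Real.rpow_mul hB]
          norm_num
  -- assemble
  have hfg_int : Integrable (fun y => f y * g y) ν := by
    refine Integrable.of_bound (C := M) (hfm.mul hgm).aestronglyMeasurable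
      (Eventually.of_forall fun y => ?_)
    rw [Real.norm_eq_abs, abs_of_nonneg (mul_nonneg (hf_nn y) (hg_nn y))]
    calc f y * g y ≤ M * 1 := mul_le_mul (hf_bdd y) (hg_le y) (hg_nn y) hM
      _ = M := mul_one M
  have hmean : ∫ y, f y ∂ν ≤ L + ∫ y, f y * g y ∂ν := by
    calc ∫ y, f y ∂ν ≤ ∫ y, (L + f y * g y) ∂ν := integral_mono hfint
          ((integrable_const L).add hfg_int) hsplit
      _ = L + ∫ y, f y * g y ∂ν := by
          rw [integral_add (integrable_const L) hfg_int, integral_const, smul_eq_mul,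
            probReal_univ, one_mul]
  have h0 : 0 ≤ ∫ y, f y ∂ν := integral_nonneg hf_nn
  have hfg : 0 ≤ ∫ y, f y * g y ∂ν := integral_nonneg fun y => mul_nonneg (hf_nn y) (hg_nn y)
  have hf2eq : ∫ y, f y ^ 2 ∂ν = ∫ y, (max (-M) (min y M)) ^ 2 ∂ν :=
    integral_congr_ae (Eventually.of_forall fun y => by simp only [hf, sq_abs])
  calc (∫ y, f y ∂ν) ^ 2 ≤ (L + ∫ y, f y * g y ∂ν) ^ 2 := pow_le_pow_left₀ h0 hmean 2
    _ ≤ 2 * L ^ 2 + 2 * (∫ y, f y * g y ∂ν) ^ 2 := by nlinarith [sq_nonneg (L - ∫ y, f y * g y ∂ν)]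
    _ ≤ 2 * L ^ 2 + 2 * ((∫ y, f y ^ 2 ∂ν) * ν.real {y | L < |y|}) := by gcongr
    _ = 2 * L ^ 2 + 2 * (∫ y, (max (-M) (min y M)) ^ 2 ∂ν) * ν.real {y | L < |y|} := by
        rw [hf2eq, mul_assoc]

/-- **(2.9), `d = 1`**: `(E X)²/(M² P(|H| > M)) → 0` as `M → ∞`, i.e. `n^{1/2} B_n^{-1} |E X_{n1}|
→ 0`. [cite: ChakrabartySamorodnitsky2012, Theorem 2.2 (proof, (2.9))] -/
theorem tendsto_sq_integral_clip_div {α : ℝ} (hα0 : 0 < α) (hα2 : α < 2)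
    (hrv : IsSlowlyVarying fun t => ν.real {y | t < |y|} / t ^ (-α)) :
    Tendsto (fun M : ℝ => (∫ y, max (-M) (min y M) ∂ν) ^ 2 / (M ^ 2 * ν.real {y | M < |y|}))
      atTop (𝓝 0) := by
  have hD := tendsto_sq_mul_tail_atTop hα2 hrv
  have hm2 := tendsto_integral_clip_sq_div hα0 hα2 hrv
  rw [Metric.tendsto_nhds]
  intro η hη
  -- the constant `C = 2/(2−α) + 1` bounds `E X²/D` eventually
  set C : ℝ := 2 / (2 - α) + 1 with hC
  have hCpos : 0 < C := by have : 0 < 2 / (2 - α) := div_pos two_pos (by linarith); linarith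
  -- choose `L` with `2 C T(L) < η/2`
  obtain ⟨L, hL0, hL⟩ : ∃ L : ℝ, 0 ≤ L ∧ 2 * C * ν.real {y | L < |y|} < η / 2 := by
    have h := (tendsto_tail_zero (ν := ν)).const_mul (2 * C)
    rw [mul_zero] at h
    obtain ⟨L, hL⟩ := ((tendsto_order.1 h).2 (η / 2) (by linarith)).and (eventually_ge_atTop 0)
      |>.exists
    exact ⟨L, hL.2, hL.1⟩
  have h1 : ∀ᶠ M : ℝ in atTop, 2 * L ^ 2 / (M ^ 2 * ν.real {y | M < |y|}) < η / 2 := by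
    have h := (tendsto_const_nhds (x := 2 * L ^ 2)).div_atTop hD
    exact (tendsto_order.1 h).2 _ (by linarith)
  have h2 : ∀ᶠ M : ℝ in atTop,
      (∫ y, (max (-M) (min y M)) ^ 2 ∂ν) / (M ^ 2 * ν.real {y | M < |y|}) < C :=
    (tendsto_order.1 hm2).2 _ (by simp [hC])
  filter_upwards [h1, h2, hD.eventually_gt_atTop 0, eventually_ge_atTop 0] with M hM1 hM2 hDM hM0
  rw [dist_zero_right, Real.norm_eq_abs, abs_of_nonneg (div_nonneg (sq_nonneg _) hDM.le)]
  have habs : (∫ y, max (-M) (min y M) ∂ν) ^ 2 ≤ (∫ y, |max (-M) (min y M)| ∂ν) ^ 2 := by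
    rw [← sq_abs]
    exact pow_le_pow_left₀ (abs_nonneg _) abs_integral_le_integral_abs 2
  have hT : 0 ≤ ν.real {y | L < |y|} := measureReal_nonneg
  calc (∫ y, max (-M) (min y M) ∂ν) ^ 2 / (M ^ 2 * ν.real {y | M < |y|})
      ≤ (2 * L ^ 2 + 2 * (∫ y, (max (-M) (min y M)) ^ 2 ∂ν) * ν.real {y | L < |y|}) /
          (M ^ 2 * ν.real {y | M < |y|}) := by
        gcongr
        exact habs.trans (sq_integral_abs_clip_le hM0 hL0)
    _ = 2 * L ^ 2 / (M ^ 2 * ν.real {y | M < |y|}) +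
          2 * ((∫ y, (max (-M) (min y M)) ^ 2 ∂ν) / (M ^ 2 * ν.real {y | M < |y|})) *
            ν.real {y | L < |y|} := by
        rw [add_div]; ring
    _ ≤ 2 * L ^ 2 / (M ^ 2 * ν.real {y | M < |y|}) + 2 * C * ν.real {y | L < |y|} := by
        gcongr
    _ < η / 2 + η / 2 := add_lt_add hM1 hL
    _ = η := by ring

/-- **(2.6), `d = 1`**: `Var X/(M² P(|H| > M)) → 2/(2−α)` as `M → ∞`, `X = clip_M H`, i.e.
`n B_n^{-2} Var(X_{n1}) → 2/(2−α)`. [cite: ChakrabartySamorodnitsky2012, Theorem 2.2 (proof, (2.6))] -/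
theorem tendsto_variance_clip_div {α : ℝ} (hα0 : 0 < α) (hα2 : α < 2)
    (hrv : IsSlowlyVarying fun t => ν.real {y | t < |y|} / t ^ (-α)) :
    Tendsto (fun M : ℝ => ((∫ y, (max (-M) (min y M)) ^ 2 ∂ν) - (∫ y, max (-M) (min y M) ∂ν) ^ 2) /
      (M ^ 2 * ν.real {y | M < |y|})) atTop (𝓝 (2 / (2 - α))) := by
  have h := (tendsto_integral_clip_sq_div hα0 hα2 hrv).sub (tendsto_sq_integral_clip_div hα0 hα2 hrv)
  rw [sub_zero] at h
  exact h.congr fun M => by rw [sub_div]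

end Law

/-! ### Theorem 2.1: soft truncation — truncated heavy tails are still heavy -/

section Sample

variable {Ω : Type*} {mΩ : MeasurableSpace Ω} {P : Measure Ω} [IsProbabilityMeasure P]
  {Ω' : Type*} {mΩ' : MeasurableSpace Ω'} {P' : Measure Ω'} [IsProbabilityMeasure P']
  {H : ℕ → Ω → ℝ} {M : ℕ → ℝ}

/-- The clipped row sum differs from the untruncated sum only on `⋃_{j<n} {|H_j| > M_n}`, an event
of probability `≤ n P(|H_1| > M_n)`: the one estimate of the printed proof of Theorem 2.1, in the
form "`P(ε ≤ |A_n − B_n|) → 0` for every `ε > 0`" under soft truncation.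
[cite: ChakrabartySamorodnitsky2012, Theorem 2.1 (proof)] -/
theorem tendsto_measure_sum_clip_ne_sum_of_soft (hident : ∀ j, IdentDistrib (H j) (H 0) P P)
    (hsoft : Tendsto (fun n : ℕ => (n : ℝ) * P.real {ω | M n < |H 0 ω|}) atTop (𝓝 0))
    (b c : ℕ → ℝ) {ε : ℝ} (hε : 0 < ε) :
    Tendsto (fun n : ℕ => P {ω | ε ≤ ‖((∑ j ∈ range n, max (-M n) (min (H j ω) (M n))) / b n - c n) -
      ((∑ j ∈ range n, H j ω) / b n - c n)‖}) atTop (𝓝 0) := by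
  -- the exceptional event and its probability
  have hsub : ∀ n : ℕ, {ω | ε ≤ ‖((∑ j ∈ range n, max (-M n) (min (H j ω) (M n))) / b n - c n) -
      ((∑ j ∈ range n, H j ω) / b n - c n)‖} ⊆ ⋃ j ∈ range n, {ω | M n < |H j ω|} := by
    intro n ω hω
    by_contra hne
    simp only [mem_iUnion, mem_setOf_eq, exists_prop, not_exists, not_and, not_lt] at hne
    have heq : ∑ j ∈ range n, max (-M n) (min (H j ω) (M n)) = ∑ j ∈ range n, H j ω :=
      Finset.sum_congr rfl fun j hj => clip_eq_self (hne j hj)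
    have : ε ≤ 0 := by simpa [heq] using hω
    exact (not_le.2 hε) this
  have hbound : ∀ n : ℕ, P {ω | ε ≤ ‖((∑ j ∈ range n, max (-M n) (min (H j ω) (M n))) / b n - c n) -
      ((∑ j ∈ range n, H j ω) / b n - c n)‖} ≤
      ENNReal.ofReal ((n : ℝ) * P.real {ω | M n < |H 0 ω|}) := by
    intro n
    calc _ ≤ P (⋃ j ∈ range n, {ω | M n < |H j ω|}) := measure_mono (hsub n)
      _ ≤ ∑ j ∈ range n, P {ω | M n < |H j ω|} := measure_biUnion_finset_le _ _
      _ = ∑ j ∈ range n, P {ω | M n < |H 0 ω|} :=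
          Finset.sum_congr rfl fun j _ => (hident j).measure_mem_eq (measurableSet_tail (M n))
      _ = ENNReal.ofReal ((n : ℝ) * P.real {ω | M n < |H 0 ω|}) := by
          rw [Finset.sum_const, Finset.card_range, nsmul_eq_mul, ENNReal.ofReal_mul (Nat.cast_nonneg n),
            ENNReal.ofReal_natCast, ofReal_measureReal]
  have h0 : Tendsto (fun n : ℕ => ENNReal.ofReal ((n : ℝ) * P.real {ω | M n < |H 0 ω|})) atTop
      (𝓝 0) := by
    have := ENNReal.tendsto_ofReal hsoft
    rwa [ENNReal.ofReal_zero] at this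
  exact tendsto_of_tendsto_of_tendsto_of_le_of_le tendsto_const_nhds h0 (fun n => bot_le) hbound

/-- **Theorem 2.1 (soft truncation: truncated heavy tails are still heavy)**, `d = 1`, `R ≡ 0`, in
limit-free form: if `nP(|H_1| > M_n) → 0` then for every norming `b_n`, centring `c_n` and every
candidate limit `Z`, `b_n^{-1} S_n − c_n ⟹ Z` iff `b_n^{-1} Σ_{j<n} H_j − c_n ⟹ Z`, where
`S_n = Σ_{j<n} max(−M_n, min(H_j, M_n))`. In particular the truncated sums have the same
(`α`-stable) limit, with the same norming, as the untruncated ones (the printed statement), and — by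
the tree's `CentralLimitNecessity.lean` — no limit law at rate `√n` when the `H_j` have infinite
variance. Only identical distribution of the `H_j` is used. [cite: ChakrabartySamorodnitsky2012, Theorem 2.1] -/
theorem tendstoInDistribution_iff_of_soft (hH : ∀ j, AEMeasurable (H j) P)
    (hident : ∀ j, IdentDistrib (H j) (H 0) P P)
    (hsoft : Tendsto (fun n : ℕ => (n : ℝ) * P.real {ω | M n < |H 0 ω|}) atTop (𝓝 0))
    (b c : ℕ → ℝ) {Z : Ω' → ℝ} :
    TendstoInDistribution (fun n ω => (∑ j ∈ range n, max (-M n) (min (H j ω) (M n))) / b n - c n)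
        atTop Z (fun _ => P) P' ↔
      TendstoInDistribution (fun n ω => (∑ j ∈ range n, H j ω) / b n - c n) atTop Z (fun _ => P) P' := by
  have hAm : ∀ n, AEMeasurable
      (fun ω => (∑ j ∈ range n, max (-M n) (min (H j ω) (M n))) / b n - c n) P := fun n =>
    ((Finset.aemeasurable_fun_sum _ fun j _ =>
      aemeasurable_const.max ((hH j).min aemeasurable_const)).div_const _).sub_const _
  have hBm : ∀ n, AEMeasurable (fun ω => (∑ j ∈ range n, H j ω) / b n - c n) P := fun n =>
    ((Finset.aemeasurable_fun_sum _ fun j _ => hH j).div_const _).sub_const _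
  constructor
  · intro hA
    refine tendstoInDistribution_of_tendstoInMeasure_sub _ Z hA ?_ hBm
    rw [tendstoInMeasure_iff_norm]
    intro ε hε
    refine (tendsto_measure_sum_clip_ne_sum_of_soft hident hsoft b c hε).congr fun n => ?_
    congr 1 with ω
    simp only [Pi.sub_apply, Pi.zero_apply, sub_zero, mem_setOf_eq, norm_sub_rev]
  · intro hB
    refine tendstoInDistribution_of_tendstoInMeasure_sub _ Z hB ?_ hAm
    rw [tendstoInMeasure_iff_norm]
    intro ε hε
    refine (tendsto_measure_sum_clip_ne_sum_of_soft hident hsoft b c hε).congr fun n => ?_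
    congr 1 with ω
    simp only [Pi.sub_apply, Pi.zero_apply, sub_zero, mem_setOf_eq]

/-- **Theorem 2.1 combined with the necessity of a finite variance (Kallenberg Thm 5.17 / Durrett
Ex. 3.4.3, the tree's `TailIndexCLTDichotomy.lean`)**: in the SOFT truncation regime a nonnegative
heavy-tailed summand (`P(H > t)` regularly varying of exponent `−α`, `0 < α < 2`) gives truncated row
sums `S_n = Σ_{j<n} max(−M_n, min(H_j, M_n))` with NO limit law at rate `√n`: for no centring `c_n`
and no real random variable `Z` does `S_n/√n − c_n ⟹ Z` («truncated heavy tails are still heavy»).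
[cite: ChakrabartySamorodnitsky2012, Theorem 2.1] [cite: Kallenberg2021, Theorem 5.17] -/
theorem not_tendstoInDistribution_sqrt_of_soft {α : ℝ} (hα0 : 0 < α) (hα2 : α < 2)
    (hH : ∀ j, AEMeasurable (H j) P) (hindep : iIndepFun H P)
    (hident : ∀ j, IdentDistrib (H j) (H 0) P P) (hnonneg : ∀ᵐ ω ∂P, 0 ≤ H 0 ω)
    (hrv : IsSlowlyVarying fun t => P.real {ω | t < |H 0 ω|} / t ^ (-α))
    (hsoft : Tendsto (fun n : ℕ => (n : ℝ) * P.real {ω | M n < |H 0 ω|}) atTop (𝓝 0))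
    (c : ℕ → ℝ) (Z : Ω' → ℝ) :
    ¬ TendstoInDistribution
      (fun n ω => (∑ j ∈ range n, max (-M n) (min (H j ω) (M n))) / √(n : ℝ) - c n)
      atTop Z (fun _ => P) P' := by
  intro h
  have h' := (tendstoInDistribution_iff_of_soft (P' := P') hH hident hsoft (fun n => √(n : ℝ)) c).1 h
  set ν : Measure ℝ := P.map (H 0) with hν
  haveI : IsProbabilityMeasure ν := Measure.isProbabilityMeasure_map (hH 0)
  -- the law of `H 0` lives on `ℝ₊`
  have hsupp : ν (Iio 0) = 0 := by
    rw [hν, Measure.map_apply_of_aemeasurable (hH 0) measurableSet_Iio]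
    exact measure_mono_null (fun ω (hω : H 0 ω < 0) (hle : 0 ≤ H 0 ω) => (not_lt.2 hle) hω)
      (ae_iff.1 hnonneg)
  -- the tail of `ν` is the tail sum of `H 0` (nonnegativity)
  have hrv' : IsSlowlyVarying fun t => ν.real (Ioi t) / t ^ (-α) := by
    have e : (fun t => ν.real (Ioi t) / t ^ (-α)) = fun t => P.real {ω | t < |H 0 ω|} / t ^ (-α) := by
      funext t
      congr 1
      rw [hν, measureReal_def, measureReal_def, Measure.map_apply_of_aemeasurable (hH 0) measurableSet_Ioi]
      congr 1
      refine measure_congr ?_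
      filter_upwards [hnonneg] with ω hω
      change (t < H 0 ω) = (t < |H 0 ω|)
      rw [abs_of_nonneg hω]
    rw [e]; exact hrv
  have key := RVIndex.not_tendstoInDistribution_of_lt_two ν (X := H) (P := P) (P' := P') Z hsupp hα0 hrv' hα2
    hindep hident rfl c
  exact key (by simpa only [div_eq_inv_mul] using h')

/-! ### Theorem 2.2: hard truncation — truncated heavy tails are no longer heavy -/

/-- **Theorem 2.2 (hard truncation: truncated heavy tails are no longer heavy)**, `d = 1`, `R ≡ 0`.
`H_0, H_1, …` i.i.d. with tail sum `P(|H| > t)` regularly varying of exponent `−α`, `0 < α < 2`;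
truncation levels `M_n → ∞` with `nP(|H| > M_n) → ∞`; `S_n = Σ_{j<n} max(−M_n, min(H_j, M_n))`,
`B_n = [n M_n² P(|H| > M_n)]^{1/2}`. Then `B_n^{-1}(S_n − ES_n) ⟹ N(0, 2/(2−α))`, realised as
`√(2/(2−α))·Z` for any standard normal `Z`. Proof as printed: Lindeberg–Feller
(`Literature.Probability.Independence.tendstoInDistribution_sum_sub_div_of_bounded`, the summands
being bounded by `M_n ≪ B_n`), with `n B_n^{-2} Var X_{n1} → 2/(2−α)` ((2.6), from Feller's (5.16))
and `n^{1/2} B_n^{-1} E X_{n1} → 0` ((2.9)). [cite: ChakrabartySamorodnitsky2012, Theorem 2.2] -/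
theorem tendstoInDistribution_of_hard {α : ℝ} (hα0 : 0 < α) (hα2 : α < 2)
    (hH : ∀ j, AEMeasurable (H j) P) (hindep : iIndepFun H P)
    (hident : ∀ j, IdentDistrib (H j) (H 0) P P)
    (hrv : IsSlowlyVarying fun t => P.real {ω | t < |H 0 ω|} / t ^ (-α))
    (hM : ∀ n, 0 < M n) (hMtop : Tendsto M atTop atTop)
    (hhard : Tendsto (fun n : ℕ => (n : ℝ) * P.real {ω | M n < |H 0 ω|}) atTop atTop)
    {Z : Ω' → ℝ} (hZ : HasLaw Z (gaussianReal 0 1) P') :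
    TendstoInDistribution
      (fun n ω => (∑ j ∈ range n, (max (-M n) (min (H j ω) (M n)) -
          P[fun ω => max (-M n) (min (H j ω) (M n))])) /
        √(n * (M n ^ 2 * P.real {ω | M n < |H 0 ω|})))
      atTop (fun ω => √(2 / (2 - α)) * Z ω) (fun _ => P) P' := by
  -- the law of `H 0` and the transfer of the tail sum
  set ν : Measure ℝ := P.map (H 0) with hν
  haveI : IsProbabilityMeasure ν := Measure.isProbabilityMeasure_map (hH 0)
  have hT : ∀ t : ℝ, P.real {ω | t < |H 0 ω|} = ν.real {y | t < |y|} := fun t => by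
    rw [measureReal_def, measureReal_def, hν,
      Measure.map_apply_of_aemeasurable (hH 0) (measurableSet_tail t)]
    rfl
  have hrvν : IsSlowlyVarying fun t => ν.real {y | t < |y|} / t ^ (-α) := by
    have e : (fun t => ν.real {y | t < |y|} / t ^ (-α)) = fun t => P.real {ω | t < |H 0 ω|} / t ^ (-α) := by
      funext t; rw [hT]
    rw [e]; exact hrv
  -- the clipped array
  set X : ℕ → ℕ → Ω → ℝ := fun n j ω => max (-M n) (min (H j ω) (M n)) with hX
  have hclipm : ∀ n, Measurable fun x : ℝ => max (-M n) (min x (M n)) := fun n =>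
    measurable_const.max (measurable_id.min measurable_const)
  have hXm : ∀ n j, AEMeasurable (X n j) P := fun n j => (hclipm n).comp_aemeasurable (hH j)
  have hXbdd : ∀ n j ω, |X n j ω| ≤ M n := fun n j ω => abs_clip_le (M n) (H j ω) (hM n).le
  have hXL2 : ∀ n j, MemLp (X n j) 2 P := fun n j =>
    MemLp.of_bound (hXm n j).aestronglyMeasurable (M n)
      (Eventually.of_forall fun ω => by rw [Real.norm_eq_abs]; exact hXbdd n j ω)
  have hidX : ∀ n j, IdentDistrib (X n j) (X n 0) P P := fun n j => (hident j).comp (hclipm n)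
  -- moments of `X n 0` as integrals against `ν`
  have hm1 : ∀ n, P[X n 0] = ∫ y, max (-M n) (min y (M n)) ∂ν := fun n => by
    rw [hν, integral_map (hH 0) (hclipm n).aestronglyMeasurable]
  have hm2 : ∀ n, P[X n 0 ^ 2] = ∫ y, (max (-M n) (min y (M n))) ^ 2 ∂ν := fun n => by
    have : AEStronglyMeasurable (fun y : ℝ => (max (-M n) (min y (M n))) ^ 2) (P.map (H 0)) :=
      ((hclipm n).pow_const 2).aestronglyMeasurable
    rw [hν, integral_map (hH 0) this]
    rfl
  have hvar : ∀ n, Var[X n 0; P] = (∫ y, (max (-M n) (min y (M n))) ^ 2 ∂ν) -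
      (∫ y, max (-M n) (min y (M n)) ∂ν) ^ 2 := fun n => by
    rw [variance_eq_sub (hXL2 n 0), hm1, hm2]
  -- (2.6): `Var X_{n1} / (M_n² T(M_n)) → 2/(2−α)`
  have h26 : Tendsto (fun n => Var[X n 0; P] / (M n ^ 2 * P.real {ω | M n < |H 0 ω|})) atTop
      (𝓝 (2 / (2 - α))) := by
    have h := (tendsto_variance_clip_div hα0 hα2 hrvν).comp hMtop
    refine h.congr fun n => ?_
    simp only [Function.comp_apply, hvar, hT]
  have hσpos : 0 < 2 / (2 - α) := div_pos two_pos (by linarith)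
  -- `n Var X_{n1} / M_n² = (n T(M_n)) · (Var/(M² T)) → ∞`
  have hTpos : ∀ᶠ n : ℕ in atTop, 0 < P.real {ω | M n < |H 0 ω|} := by
    filter_upwards [hhard.eventually_gt_atTop 0] with n hn
    rcases (measureReal_nonneg (μ := P) (s := {ω | M n < |H 0 ω|})).eq_or_lt with h | h
    · rw [← h, mul_zero] at hn; exact absurd hn (lt_irrefl 0)
    · exact h
  have hratio : Tendsto (fun n : ℕ => (n : ℝ) * Var[X n 0; P] / M n ^ 2) atTop atTop := by
    refine (hhard.atTop_mul_pos hσpos h26).congr' ?_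
    filter_upwards [hTpos] with n hn
    have hM2 : M n ^ 2 ≠ 0 := pow_ne_zero 2 (hM n).ne'
    field_simp
  -- the row sums of variances
  have hsumvar : ∀ n, ∑ j ∈ range n, Var[X n j; P] = n * Var[X n 0; P] := fun n => by
    rw [Finset.sum_congr rfl fun j _ => (hidX n j).variance_eq, Finset.sum_const, Finset.card_range,
      nsmul_eq_mul]
  have hpos : ∀ᶠ n : ℕ in atTop, 0 < ∑ j ∈ range n, Var[X n j; P] := by
    filter_upwards [hratio.eventually_gt_atTop 0] with n hn
    rw [hsumvar]
    rcases (mul_nonneg (Nat.cast_nonneg n) (variance_nonneg (X n 0) P)).eq_or_lt with h | h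
    · rw [← h, zero_div] at hn; exact absurd hn (lt_irrefl 0)
    · exact h
  have hK : Tendsto (fun n : ℕ => M n ^ 2 / ∑ j ∈ range n, Var[X n j; P]) atTop (𝓝 0) := by
    refine (tendsto_inv_atTop_zero.comp hratio).congr fun n => ?_
    simp only [Function.comp_apply, hsumvar, inv_div]
  -- Lindeberg–Feller for the bounded array
  have key := tendstoInDistribution_sum_sub_div_of_bounded (Ω := fun _ => Ω) (P := fun _ => P)
    (X := X) (N := id) (K := M) (fun n j _ => hXm n j)
    (fun n j _ => Eventually.of_forall (hXbdd n j))
    (fun n => hindep.comp (fun j x => max (-M n) (min x (M n))) fun j => hclipm n) hpos hK hZ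
  -- rescale from `√(Σ Var)` to `B_n`: the deterministic factor `√(Σ Var)/B_n → √(2/(2−α))`
  set r : ℕ → ℝ := fun n => √(∑ j ∈ range n, Var[X n j; P]) /
    √(n * (M n ^ 2 * P.real {ω | M n < |H 0 ω|})) with hr
  have hrlim : Tendsto r atTop (𝓝 √(2 / (2 - α))) := by
    have h := (Real.continuous_sqrt.tendsto _).comp h26
    refine h.congr' ?_
    filter_upwards [hTpos, eventually_gt_atTop 0] with n hn hn0
    simp only [hr, Function.comp_apply, hsumvar]
    rw [← Real.sqrt_div' _ , mul_div_mul_left _ _ (Nat.cast_pos.2 hn0).ne']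
    positivity
  have hrmeas : TendstoInMeasure P (fun (n : ℕ) (_ : Ω) => r n) atTop (fun _ => √(2 / (2 - α))) := by
    rw [tendstoInMeasure_iff_dist]
    intro ε hε
    refine tendsto_const_nhds.congr' ?_
    filter_upwards [(Metric.tendsto_nhds.1 hrlim) ε hε] with n hn
    have : {ω : Ω | ε ≤ dist (r n) √(2 / (2 - α))} = ∅ := by
      ext ω; simp only [mem_setOf_eq, mem_empty_iff_false, iff_false, not_le]; exact hn
    rw [this, measure_empty]
  have slutsky := key.continuous_comp_prodMk_of_tendstoInMeasure_const
    (g := fun p : ℝ × ℝ => p.2 * p.1) (by fun_prop) hrmeas (fun n => aemeasurable_const)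
  -- the two normalisations agree as soon as `Σ Var > 0`
  refine ⟨fun n => ?_, by have := hZ.aemeasurable; fun_prop, ?_⟩
  · exact ((Finset.aemeasurable_fun_sum _ fun j _ => (hXm n j).sub_const _).div_const _)
  · refine slutsky.tendsto.congr' ?_
    filter_upwards [hpos] with n hn
    have hs : √(∑ j ∈ range n, Var[X n j; P]) ≠ 0 := (Real.sqrt_pos.2 hn).ne'
    congr 1
    refine Measure.map_congr (Eventually.of_forall fun ω => ?_)
    have e : r n * ((∑ m ∈ range (id n), (X n m ω - ∫ x, X n m x ∂P)) /
        √(∑ m ∈ range (id n), Var[X n m; P])) =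
        (∑ j ∈ range n, (X n j ω - ∫ x, X n j x ∂P)) /
          √(n * (M n ^ 2 * P.real {ω | M n < |H 0 ω|})) := by
      simp only [hr, id_eq]
      rw [div_mul_div_comm, mul_comm (√(∑ j ∈ range n, Var[X n j; P])), mul_div_mul_right _ _ hs]
    exact e

/-! ### Proposition 4.1 (ii): under hard truncation the largest share of `Σ|X_i|^A` vanishes -/

/-- **Proposition 4.1 (ii)** (`d = 1`, `R ≡ 0`), in share form: under HARD truncation the statistic
`Z_n(A) = Σ_{i≤n}|X_i|^A / max_i |X_i|^A` of (4.3) tends to `∞` in probability — equivalently, for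
every `ε > 0` the probability that SOME summand carries a share `≥ ε` of `Σ_i |X_i|^A` tends to `0`.
Printed proof: the `≈ (2^α − 1) n P(|H| > M_n) → ∞` observations with `M_n/2 < |H_i| ≤ M_n` each
contribute `≥ (M_n/2)^A` while `max|X_i|^A ≤ M_n^A` (here: a binomial Chebyshev bound). Valid for every
tail exponent `α > 0` and every `A > 0`. [cite: ChakrabartySamorodnitsky2012, Proposition 4.1 (ii)] -/
theorem tendsto_measure_exists_share_ge_of_hard {α A : ℝ} (hα0 : 0 < α) (hA : 0 < A)
    (hH : ∀ j, AEMeasurable (H j) P) (hindep : iIndepFun H P)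
    (hident : ∀ j, IdentDistrib (H j) (H 0) P P)
    (hrv : IsSlowlyVarying fun t => P.real {ω | t < |H 0 ω|} / t ^ (-α))
    (hM : ∀ n, 0 < M n) (hMtop : Tendsto M atTop atTop)
    (hhard : Tendsto (fun n : ℕ => (n : ℝ) * P.real {ω | M n < |H 0 ω|}) atTop atTop)
    {ε : ℝ} (hε : 0 < ε) :
    Tendsto (fun n : ℕ => P {ω | ∃ j ∈ Finset.range n,
        ε * ∑ i ∈ Finset.range n, |max (-M n) (min (H i ω) (M n))| ^ A ≤
          |max (-M n) (min (H j ω) (M n))| ^ A}) atTop (𝓝 0) := by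
  -- the law of `H 0` and the transfer of probabilities
  set ν : Measure ℝ := P.map (H 0) with hν
  haveI : IsProbabilityMeasure ν := Measure.isProbabilityMeasure_map (hH 0)
  have hT : ∀ t : ℝ, P.real {ω | t < |H 0 ω|} = ν.real {y | t < |y|} := fun t => by
    rw [measureReal_def, measureReal_def, hν,
      Measure.map_apply_of_aemeasurable (hH 0) (measurableSet_tail t)]
    rfl
  -- the window `B_n = {M_n/2 < |x| ≤ M_n}` and the count of observations in it
  set B : ℕ → Set ℝ := fun n => {x | M n / 2 < |x| ∧ |x| ≤ M n} with hB
  have hBm : ∀ n, MeasurableSet (B n) := fun n =>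
    (measurableSet_lt measurable_const continuous_abs.measurable).inter
      (measurableSet_le continuous_abs.measurable measurable_const)
  have hBeq : ∀ n, B n = {y | M n / 2 < |y|} \ {y | M n < |y|} := fun n => by
    ext y; simp only [hB, Set.mem_setOf_eq, Set.mem_sdiff, not_lt]
  set I : ℕ → ℕ → Ω → ℝ := fun n j ω => (B n).indicator (fun _ => (1 : ℝ)) (H j ω) with hI
  have hIm' : ∀ n, Measurable fun x : ℝ => (B n).indicator (fun _ => (1 : ℝ)) x := fun n =>
    measurable_const.indicator (hBm n)
  have hIm : ∀ n j, AEMeasurable (I n j) P := fun n j => (hIm' n).comp_aemeasurable (hH j)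
  have hI01 : ∀ n j ω, I n j ω = 0 ∨ I n j ω = 1 := fun n j ω => by
    simp only [hI, indicator_apply]; split_ifs <;> simp
  have hInn : ∀ n j ω, 0 ≤ I n j ω := fun n j ω => by rcases hI01 n j ω with h | h <;> simp [h]
  have hIle : ∀ n j ω, I n j ω ≤ 1 := fun n j ω => by rcases hI01 n j ω with h | h <;> simp [h]
  have hIL2 : ∀ n j, MemLp (I n j) 2 P := fun n j =>
    MemLp.of_bound (hIm n j).aestronglyMeasurable 1 (Eventually.of_forall fun ω => by
      rw [Real.norm_eq_abs, abs_of_nonneg (hInn n j ω)]; exact hIle n j ω)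
  set p : ℕ → ℝ := fun n => ν.real (B n) with hp
  have hIdI : ∀ n j, IdentDistrib (I n j) (I n 0) P P := fun n j => (hident j).comp (hIm' n)
  have hEI : ∀ n j, P[I n j] = p n := fun n j => by
    rw [(hIdI n j).integral_eq]
    simp only [hI]
    rw [← integral_map (hH 0) (hIm' n).aestronglyMeasurable, integral_indicator (hBm n),
      setIntegral_const, smul_eq_mul, mul_one]
  -- the count `N_n = Σ_{j<n} I_{nj}`: mean `n p_n`, variance `≤ n p_n`
  have hNmean : ∀ n, P[fun ω => ∑ j ∈ Finset.range n, I n j ω] = n * p n := fun n => by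
    rw [integral_finsetSum _ fun j _ => (hIL2 n j).integrable one_le_two,
      Finset.sum_congr rfl fun j _ => hEI n j, Finset.sum_const, Finset.card_range, nsmul_eq_mul]
  have hNvar : ∀ n, Var[fun ω => ∑ j ∈ Finset.range n, I n j ω; P] ≤ n * p n := fun n => by
    have hpair : Set.Pairwise ↑(range n) fun i j => IndepFun (I n i) (I n j) P := fun i _ j _ hij =>
      (hindep.comp (fun _ x => (B n).indicator (fun _ => (1 : ℝ)) x) fun _ => hIm' n).indepFun hij
    have h := IndepFun.variance_sum (fun j _ => hIL2 n j) hpair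
    rw [show (fun ω => ∑ j ∈ Finset.range n, I n j ω) = ∑ j ∈ Finset.range n, I n j from by
      funext ω; simp only [Finset.sum_apply], h]
    calc ∑ j ∈ Finset.range n, Var[I n j; P] ≤ ∑ j ∈ Finset.range n, P[(I n j) ^ 2] :=
          Finset.sum_le_sum fun j _ => variance_le_expectation_sq (hIm n j).aestronglyMeasurable
      _ = ∑ j ∈ Finset.range n, p n := Finset.sum_congr rfl fun j _ => by
          rw [← hEI n j]
          congr 1
          funext ω
          simp only [Pi.pow_apply]
          rcases hI01 n j ω with h | h <;> simp [h]
      _ = n * p n := by rw [Finset.sum_const, Finset.card_range, nsmul_eq_mul]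
  -- `n p_n → ∞`: `p_n = T(M_n/2) − T(M_n)` and `T(M/2)/T(M) → 2^α`
  have hTpos : ∀ᶠ n : ℕ in atTop, 0 < P.real {ω | M n < |H 0 ω|} := by
    filter_upwards [hhard.eventually_gt_atTop 0] with n hn
    rcases (measureReal_nonneg (μ := P) (s := {ω | M n < |H 0 ω|})).eq_or_lt with h | h
    · rw [← h, mul_zero] at hn; exact absurd hn (lt_irrefl 0)
    · exact h
  have hratio : Tendsto (fun n : ℕ => P.real {ω | M n / 2 < |H 0 ω|} / P.real {ω | M n < |H 0 ω|})
      atTop (𝓝 ((2 : ℝ) ^ α)) := by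
    -- slow variation of `L(t) = T(t)/t^{−α}` at `c = 1/2`, along `M_n → ∞`
    have hL := (hrv (1 / 2) (by norm_num)).comp hMtop
    have h2 : Tendsto (fun n : ℕ => (2 : ℝ) ^ α * ((fun x => P.real {ω | 1 / 2 * x < |H 0 ω|} /
        (1 / 2 * x) ^ (-α) / (P.real {ω | x < |H 0 ω|} / x ^ (-α))) ∘ M) n) atTop (𝓝 ((2 : ℝ) ^ α * 1)) :=
      hL.const_mul _
    rw [mul_one] at h2
    refine h2.congr' ?_
    filter_upwards [hTpos] with n hn
    simp only [Function.comp_apply]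
    have hMn := hM n
    have h1 : (1 / 2 * M n) ^ (-α) = (2 : ℝ) ^ α * (M n) ^ (-α) := by
      rw [Real.mul_rpow (by norm_num) hMn.le, Real.rpow_neg (by norm_num : (0:ℝ) ≤ 1 / 2),
        one_div, Real.inv_rpow (by norm_num : (0:ℝ) ≤ 2), inv_inv]
    have hMa : (M n) ^ (-α) ≠ 0 := (Real.rpow_pos_of_pos hMn _).ne'
    have h2a : (2 : ℝ) ^ α ≠ 0 := (Real.rpow_pos_of_pos two_pos _).ne'
    rw [h1, show (1 / 2 : ℝ) * M n = M n / 2 by ring]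
    field_simp
  have hnp : Tendsto (fun n : ℕ => (n : ℝ) * p n) atTop atTop := by
    have h1 : Tendsto (fun n : ℕ => P.real {ω | M n / 2 < |H 0 ω|} / P.real {ω | M n < |H 0 ω|} - 1)
        atTop (𝓝 ((2 : ℝ) ^ α - 1)) := hratio.sub_const 1
    have hc : 0 < (2 : ℝ) ^ α - 1 := by
      have : (1 : ℝ) < (2 : ℝ) ^ α := Real.one_lt_rpow (by norm_num) hα0
      linarith
    refine (hhard.atTop_mul_pos hc h1).congr' ?_
    filter_upwards [hTpos] with n hn
    have hsub : {y : ℝ | M n < |y|} ⊆ {y | M n / 2 < |y|} := fun y (hy : M n < |y|) => by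
      show M n / 2 < |y|; linarith [hM n]
    rw [hp]
    simp only
    rw [hBeq n, measureReal_sdiff hsub (measurableSet_tail (M n)), ← hT, ← hT]
    field_simp
  -- Chebyshev: `P(N_n ≤ n p_n / 2) ≤ 4/(n p_n)`
  have hcheb : ∀ᶠ n : ℕ in atTop, P {ω | ∑ j ∈ Finset.range n, I n j ω ≤ n * p n / 2} ≤
      ENNReal.ofReal (4 / (n * p n)) := by
    filter_upwards [hnp.eventually_gt_atTop 0] with n hn
    have hL2 : MemLp (fun ω => ∑ j ∈ Finset.range n, I n j ω) 2 P := memLp_finsetSum _ fun j _ => hIL2 n j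
    have hc : 0 < n * p n / 2 := by linarith
    have h := meas_ge_le_variance_div_sq hL2 hc
    rw [hNmean n] at h
    calc P {ω | ∑ j ∈ Finset.range n, I n j ω ≤ n * p n / 2}
        ≤ P {ω | n * p n / 2 ≤ |∑ j ∈ Finset.range n, I n j ω - n * p n|} :=
          measure_mono fun ω (hω : ∑ j ∈ Finset.range n, I n j ω ≤ n * p n / 2) => by
            show n * p n / 2 ≤ |∑ j ∈ Finset.range n, I n j ω - n * p n|
            rw [abs_of_nonpos (by linarith)]; linarith
      _ ≤ ENNReal.ofReal (Var[fun ω => ∑ j ∈ Finset.range n, I n j ω; P] / (n * p n / 2) ^ 2) := h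
      _ ≤ ENNReal.ofReal (4 / (n * p n)) := by
          refine ENNReal.ofReal_le_ofReal ?_
          rw [div_le_div_iff₀ (by positivity) (by positivity)]
          nlinarith [hNvar n, variance_nonneg (fun ω => ∑ j ∈ Finset.range n, I n j ω) P]
  -- on the share event the count is `≤ 2^A/ε`
  have hevent : ∀ n, {ω | ∃ j ∈ Finset.range n, ε * ∑ i ∈ Finset.range n, |max (-M n) (min (H i ω) (M n))| ^ A ≤
      |max (-M n) (min (H j ω) (M n))| ^ A} ⊆ {ω | ∑ j ∈ Finset.range n, I n j ω ≤ (2 : ℝ) ^ A / ε} := by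
    intro n ω hω
    obtain ⟨j, hj, hle⟩ := hω
    have hMn := hM n
    -- each window observation contributes at least `(M_n/2)^A`
    have hlow : (M n / 2) ^ A * ∑ i ∈ Finset.range n, I n i ω ≤
        ∑ i ∈ Finset.range n, |max (-M n) (min (H i ω) (M n))| ^ A := by
      rw [Finset.mul_sum]
      refine Finset.sum_le_sum fun i _ => ?_
      rcases hI01 n i ω with h0 | h1
      · rw [h0, mul_zero]; exact Real.rpow_nonneg (abs_nonneg _) _
      · rw [h1, mul_one]
        have hmem : H i ω ∈ B n := by
          by_contra hni; simp [hI, indicator_of_notMem hni] at h1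
        have hclip : max (-M n) (min (H i ω) (M n)) = H i ω := clip_eq_self hmem.2
        rw [hclip]
        exact Real.rpow_le_rpow (by linarith) hmem.1.le hA.le
    -- the dominating observation is at most `M_n^A`
    have hup : |max (-M n) (min (H j ω) (M n))| ^ A ≤ (M n) ^ A :=
      Real.rpow_le_rpow (abs_nonneg _) (abs_clip_le (M n) (H j ω) hMn.le) hA.le
    have hkey : ε * ((M n / 2) ^ A * ∑ i ∈ Finset.range n, I n i ω) ≤ (M n) ^ A :=
      le_trans (mul_le_mul_of_nonneg_left hlow hε.le) (hle.trans hup)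
    have hpow : (M n / 2) ^ A = (M n) ^ A / (2 : ℝ) ^ A := Real.div_rpow hMn.le (by norm_num) A
    have hMA : 0 < (M n) ^ A := Real.rpow_pos_of_pos hMn _
    have h2A : 0 < (2 : ℝ) ^ A := Real.rpow_pos_of_pos two_pos _
    show ∑ j ∈ Finset.range n, I n j ω ≤ (2 : ℝ) ^ A / ε
    rw [hpow] at hkey
    have h2A' : (2 : ℝ) ^ A ≠ 0 := h2A.ne'
    have hq : 0 < (M n) ^ A / (2 : ℝ) ^ A := div_pos hMA h2A
    have h1 : (ε * ∑ i ∈ Finset.range n, I n i ω) * ((M n) ^ A / (2 : ℝ) ^ A) ≤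
        (2 : ℝ) ^ A * ((M n) ^ A / (2 : ℝ) ^ A) := by
      calc (ε * ∑ i ∈ Finset.range n, I n i ω) * ((M n) ^ A / (2 : ℝ) ^ A)
          = ε * ((M n) ^ A / (2 : ℝ) ^ A * ∑ i ∈ Finset.range n, I n i ω) := by ring
        _ ≤ (M n) ^ A := hkey
        _ = (2 : ℝ) ^ A * ((M n) ^ A / (2 : ℝ) ^ A) := by
            rw [mul_comm ((2 : ℝ) ^ A), div_mul_cancel₀ _ h2A']
    have h2 := le_of_mul_le_mul_right h1 hq
    rw [le_div_iff₀ hε]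
    linarith
  -- assemble
  have hsmall : Tendsto (fun n : ℕ => ENNReal.ofReal (4 / (n * p n))) atTop (𝓝 0) := by
    have h := (tendsto_const_nhds (x := (4 : ℝ))).div_atTop hnp
    have := ENNReal.tendsto_ofReal h
    rwa [ENNReal.ofReal_zero] at this
  refine tendsto_of_tendsto_of_tendsto_of_le_of_le' tendsto_const_nhds hsmall
    (Eventually.of_forall fun n => bot_le) ?_
  have hbig : ∀ᶠ n : ℕ in atTop, (2 : ℝ) ^ A / ε ≤ n * p n / 2 := by
    have := hnp.eventually_ge_atTop (2 * ((2 : ℝ) ^ A / ε))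
    filter_upwards [this] with n hn
    linarith
  filter_upwards [hcheb, hbig] with n hn hbn
  exact (measure_mono ((hevent n).trans fun ω (hω : ∑ j ∈ Finset.range n, I n j ω ≤ (2 : ℝ) ^ A / ε) =>
    show ∑ j ∈ Finset.range n, I n j ω ≤ n * p n / 2 from hω.trans hbn)).trans hn

end Sample

end TruncatedHeavyTails

end Literature.Probability.HeavyTails
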